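import Mathlib
import Summits.Ventures.HodgeRepro2.T5GlobalLatticeAlmostAll

/-!
# AN INTEGRAL UNIMODULAR GRAM MATRIX HAS NO BAD PLACE

Tier-5 support N3 / §G-N4.2 (seat p3, gen 82). File 222 defines the bad set of a square matrix `H` over a number
field `L` — the finite places at which an entry of `H` or of `H⁻¹` is not a local integer — and proves it finite.
This file shows it is EMPTY for the matrices of the lane's interest, those with entries in `𝓞_L` and determinant a
unit of `𝓞_L` (file 237's toy matrix `diag(1, 1, −1)` being one): every global integer is a local integer at every
finite place (Mathlib's `coe_mem_adicCompletionIntegers`), and the inverse of an integral unimodular matrix is the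
integral matrix `M⁻¹` (Mathlib's `nonsing_inv_mul` transported along `algebraMap (𝓞 L) L`).

* `isInteger_algebraMap_ringOfIntegers` — `x ∈ 𝓞_L` is a local integer at every `w`;
* `inv_mapMatrix` — `(M.map ι)⁻¹ = M⁻¹.map ι` for `det M ∈ 𝓞_Lˣ`; `isUnit_det_mapMatrix`;
* **`notMem_badSet_mapMatrix`**, **`badSet_mapMatrix_eq_empty`** — `badSet (M.map ι) = ∅` for every
  `M ∈ GL_n(𝓞_L)`; `forall_notMem_badSet_mapMatrix` (the lane's `hbad` hypothesis, discharged).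

§8(d): uses an L-value-free non-vanishing device: NO.
-/

open NumberField IsDedekindDomain IsDedekindDomain.HeightOneSpectrum Matrix
open Summit.Ventures.HodgeRepro2.T5GlobalLatticeAlmostAll

namespace Summit.Ventures.HodgeRepro2.T5IntegralGramBadSet

variable {L : Type*} [Field L] [NumberField L]

/-- **A global integer is a local integer at every finite place** (Mathlib's `coe_mem_adicCompletionIntegers`). -/
theorem isInteger_algebraMap_ringOfIntegers (w : HeightOneSpectrum (𝓞 L)) (r : 𝓞 L) :
    IsLocalization.IsInteger (w.adicCompletionIntegers L)
      (algebraMap L (w.adicCompletion L) (algebraMap (𝓞 L) L r)) := by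
  refine ⟨⟨algebraMap (𝓞 L) (w.adicCompletion L) r, coe_mem_adicCompletionIntegers w r⟩, ?_⟩
  change algebraMap (𝓞 L) (w.adicCompletion L) r = algebraMap L (w.adicCompletion L) (algebraMap (𝓞 L) L r)
  exact IsScalarTower.algebraMap_apply (𝓞 L) L (w.adicCompletion L) r

variable {ι : Type*} [Fintype ι] [DecidableEq ι]

omit [NumberField L] in
/-- **The inverse of an integral unimodular matrix is integral**: `(M.map ι)⁻¹ = M⁻¹.map ι` when `det M ∈ 𝓞_Lˣ`
(`M⁻¹ M = 1` in `𝓞_L`, transported along `algebraMap (𝓞 L) L`). -/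
theorem inv_mapMatrix (M : Matrix ι ι (𝓞 L)) (hM : IsUnit M.det) :
    ((algebraMap (𝓞 L) L).mapMatrix M)⁻¹ = (algebraMap (𝓞 L) L).mapMatrix M⁻¹ :=
  Matrix.inv_eq_left_inv (by rw [← map_mul, Matrix.nonsing_inv_mul M hM, map_one])

omit [NumberField L] in
/-- `det (M.map ι) = ι (det M)` is a unit when `det M` is. -/
theorem isUnit_det_mapMatrix (M : Matrix ι ι (𝓞 L)) (hM : IsUnit M.det) :
    IsUnit ((algebraMap (𝓞 L) L).mapMatrix M).det := by
  rw [← RingHom.map_det]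
  exact hM.map _

/-- **An integral unimodular matrix is good at every finite place**: `w ∉ badSet (M.map ι)` for `det M ∈ 𝓞_Lˣ`. -/
theorem notMem_badSet_mapMatrix (M : Matrix ι ι (𝓞 L)) (hM : IsUnit M.det) (w : HeightOneSpectrum (𝓞 L)) :
    w ∉ badSet ((algebraMap (𝓞 L) L).mapMatrix M) := by
  rintro ⟨i, j, h | h⟩
  · apply h
    rw [RingHom.mapMatrix_apply, Matrix.map_apply]
    exact isInteger_algebraMap_ringOfIntegers w _
  · apply h
    rw [inv_mapMatrix M hM, RingHom.mapMatrix_apply, Matrix.map_apply]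
    exact isInteger_algebraMap_ringOfIntegers w _

/-- **`badSet (M.map ι) = ∅`** for every `M ∈ GL_n(𝓞_L)`. -/
theorem badSet_mapMatrix_eq_empty (M : Matrix ι ι (𝓞 L)) (hM : IsUnit M.det) :
    badSet ((algebraMap (𝓞 L) L).mapMatrix M) = ∅ :=
  Set.eq_empty_of_forall_notMem (notMem_badSet_mapMatrix M hM)

/-- The lane's hypothesis «every place above `v` is good for `H`», discharged for `H = M.map ι`, `det M ∈ 𝓞_Lˣ`
(any base ring `R` and any place `v` of it). -/
theorem forall_notMem_badSet_mapMatrix {R : Type*} [CommRing R] [IsDedekindDomain R] [Algebra R (𝓞 L)]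
    (v : HeightOneSpectrum R) (M : Matrix ι ι (𝓞 L)) (hM : IsUnit M.det) :
    ∀ w : HeightOneSpectrum (𝓞 L), w.asIdeal.LiesOver v.asIdeal →
      w ∉ badSet ((algebraMap (𝓞 L) L).mapMatrix M) :=
  fun w _ => notMem_badSet_mapMatrix M hM w

end Summit.Ventures.HodgeRepro2.T5IntegralGramBadSet
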